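import Mathlib
import Summits.KontsevichZagierPeriods.KontsevichZagierPeriods.Theorems.SoloInformedLegendreHomotopy
import Summits.KontsevichZagierPeriods.KontsevichZagierPeriods.Theorems.SoloInformedLegendreArcsine
import HarnessLib
import HarnessLib.Audit

/-!
# Legendre's relation is a theorem of the Kontsevich–Zagier calculus (solo-informed, s33)

**THEOREM XVII.**  Let `μ ∈ (0,1)` be a real algebraic number, `μ' = 1 − μ`, and let
`K_m = [(0,1), dx/√((1−x²)(1−mx²))]`, `E_m = [(0,1), (1−mx²)dx/√((1−x²)(1−mx²))]` (`m = μ, μ'`)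
be the complete elliptic integrals of the first and second kind as one-dimensional
integral representations (parameter `m = k²`).  Then in the formal period ring
`P = FormalRep ⧸ relations` of the Kontsevich–Zagier calculus

  `2·(⟦E_μ⟧⟦K_{μ'}⟧ + ⟦E_{μ'}⟧⟦K_μ⟧ − ⟦K_μ⟧⟦K_{μ'}⟧) = ⟦[disc, 1]⟧ = ⟦π⟧`
  (`soloInformed_legendre_relation`),

i.e. Legendre's relation `EK' + E'K − KK' = π/2` holds *by the three rules* (additivity, algebraic
change of variables, Newton–Leibniz), not merely numerically; the numerical relation is recovered
by evaluation (`soloInformed_legendre_relation_value`).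

Proof (files I–VI).  Fubini (the product in `P`) turns the left side into
`2·⟦[(0,1)², (1 − μs² − μ't²)·k(s,t,μ)]⟧`; the deformation theorem (Newton–Leibniz in the
modulus `m ∈ [0, μ]`, the `m`-derivative being `∂_s A + ∂_t B`, files I–IV) replaces the integrand
by its value at `m = 0`, `(1 − s²)^{-1/2}` (file V); Fubini again and `⟦[(0,1), 1]⟧ = 1` give
`2·⟦[(0,1), (1−s²)^{-1/2}]⟧`, the substitution `u = s²` gives `⟦[(0,1), u^{-1/2}(1−u)^{-1/2}]⟧ =
⟦B(½,½)⟧`, and `⟦B(½,½)⟧ = ⟦π⟧` is the Euler–lemniscate theorem of s22.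

Consequence for the period conjecture on the elliptic sector: the transcendental ("π-cancellation")
half of the conjecture restricted to `ℚ(⟦K_μ⟧, ⟦E_μ⟧, ⟦K_{μ'}⟧, ⟦E_{μ'}⟧, ⟦π⟧)` is discharged by a
theorem; what remains there is exactly Grothendieck's period conjecture for `H¹` of the Legendre
curve `y² = (1−x²)(1−μx²)` (cf. `Literature.Barriers.KontsevichZagierPeriods`).

References: A.-M. Legendre, *Traité des fonctions elliptiques* I (1825) (as cited by McKean–Moll);
E. T. Whittaker, G. N. Watson, *A Course of Modern Analysis* (4th ed.), § 22.735 (the relation),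
§ 22.736 and Examples 22.7.15, 22.7.17 (the classical proof: `d/dc`, then `k → 0`); H. McKean, V. Moll,
*Elliptic Curves* (1997), § 2.4; M. Kontsevich, D. Zagier, *Periods* (2001), §§ 1.1–1.2, 4.1; this work
(solo-informed s33).
-/

noncomputable section

open MeasureTheory Set Filter
open scoped Classical

open Literature.NumberTheory.Transcendental Literature.NumberTheory.Transcendental.KZ
open Literature.ModelTheory.ExponentialFields

namespace Summit.KontsevichZagierPeriods.KontsevichZagierPeriods.Theorems

/-! ### THEOREM XVII -/

/-- **THEOREM XVII (Legendre's relation in the Kontsevich–Zagier calculus).**  Let `μ ∈ (0,1)` be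
real algebraic and let `K, E` (resp. `K', E'`) be representations on `(0,1)` of the complete
elliptic integrals of the first and second kind with parameter `μ` (resp. `1 − μ`):
integrands `((1−x²)(1−μx²))^{-1/2}`, `(1−μx²)((1−x²)(1−μx²))^{-1/2}` (resp. with `1 − μ`).  Then

  `2·(⟦E⟧⟦K'⟧ + ⟦E'⟧⟦K⟧ − ⟦K⟧⟦K'⟧) = ⟦[disc, 1]⟧`

in the formal period ring `FormalRep ⧸ relations`: Legendre's relation `EK' + E'K − KK' = π/2` is
a consequence of the three Kontsevich–Zagier rules.  Proof: Fubini; the deformation theorem in the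
modulus (file V); Fubini and `⟦[(0,1),1]⟧ = 1`; `2⟦arcsine⟧ = ⟦π⟧` (file VI). [this work] -/
theorem soloInformed_legendre_relation (μ : ℝ) (hμ : μ ∈ Ioo (0:ℝ) 1) (hμa : IsAlgebraic ℚ μ)
    (K K' E E' : IntegralRep 1)
    (hKd : K.domain = {x : Fin 1 → ℝ | x 0 ∈ Ioo (0:ℝ) 1})
    (hKi : EqOn K.integrand (fun x => (√(1 - x 0 ^ 2))⁻¹ * (√(1 - μ * x 0 ^ 2))⁻¹) K.domain)
    (hK'd : K'.domain = {x : Fin 1 → ℝ | x 0 ∈ Ioo (0:ℝ) 1})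
    (hK'i : EqOn K'.integrand
      (fun x => (√(1 - x 0 ^ 2))⁻¹ * (√(1 - (1 - μ) * x 0 ^ 2))⁻¹) K'.domain)
    (hEd : E.domain = {x : Fin 1 → ℝ | x 0 ∈ Ioo (0:ℝ) 1})
    (hEi : EqOn E.integrand
      (fun x => (1 - μ * x 0 ^ 2) * ((√(1 - x 0 ^ 2))⁻¹ * (√(1 - μ * x 0 ^ 2))⁻¹)) E.domain)
    (hE'd : E'.domain = {x : Fin 1 → ℝ | x 0 ∈ Ioo (0:ℝ) 1})
    (hE'i : EqOn E'.integrand (fun x => (1 - (1 - μ) * x 0 ^ 2) *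
      ((√(1 - x 0 ^ 2))⁻¹ * (√(1 - (1 - μ) * x 0 ^ 2))⁻¹)) E'.domain) :
    2 * (toFormalPeriod (of E) * toFormalPeriod (of K') + toFormalPeriod (of E') * toFormalPeriod (of K)
      - toFormalPeriod (of K) * toFormalPeriod (of K')) = toFormalPeriod (of KZ.piRep) := by
  obtain ⟨Rμ, R₀, hRμd, hRμi, hR₀d, hR₀i, hdef⟩ := soloInformed_legendre_deformation μ hμ hμa
  -- Fubini: the three products
  obtain ⟨hP1d, hP1i⟩ := soloInformed_prod_one_one E K'
    (fun u => (1 - μ * u ^ 2) * ((√(1 - u ^ 2))⁻¹ * (√(1 - μ * u ^ 2))⁻¹))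
    (fun u => (√(1 - u ^ 2))⁻¹ * (√(1 - (1 - μ) * u ^ 2))⁻¹) hEd hK'd
    (fun x hx => hEi hx) (fun x hx => hK'i hx)
  obtain ⟨hP2d, hP2i⟩ := soloInformed_prod_one_one K E'
    (fun u => (√(1 - u ^ 2))⁻¹ * (√(1 - μ * u ^ 2))⁻¹)
    (fun u => (1 - (1 - μ) * u ^ 2) * ((√(1 - u ^ 2))⁻¹ * (√(1 - (1 - μ) * u ^ 2))⁻¹)) hKd hE'd
    (fun x hx => hKi hx) (fun x hx => hE'i hx)
  obtain ⟨hP3d, hP3i⟩ := soloInformed_prod_one_one K K'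
    (fun u => (√(1 - u ^ 2))⁻¹ * (√(1 - μ * u ^ 2))⁻¹)
    (fun u => (√(1 - u ^ 2))⁻¹ * (√(1 - (1 - μ) * u ^ 2))⁻¹) hKd hK'd
    (fun x hx => hKi hx) (fun x hx => hK'i hx)
  have hbox : IsSemialgebraic ℚ {z : Fin 2 → ℝ | z 0 ∈ Ioo (0:ℝ) 1 ∧ z 1 ∈ Ioo (0:ℝ) 1} := by
    rw [← soloInformed_box_two_eq]; exact isSemialgebraic_box 2
  -- the difference of the last two products as one representation on the square
  have h2sa := (K.prod E').isSemialgebraicFunOn_integrand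
  have h3sa := (K.prod K').isSemialgebraicFunOn_integrand
  have h2i := (K.prod E').integrableOn
  have h3i := (K.prod K').integrableOn
  rw [hP2d] at h2sa h2i
  rw [hP3d] at h3sa h3i
  set Q : IntegralRep 2 := ⟨{z : Fin 2 → ℝ | z 0 ∈ Ioo (0:ℝ) 1 ∧ z 1 ∈ Ioo (0:ℝ) 1},
    fun z => (K.prod E').integrand z - (K.prod K').integrand z, hbox,
    (h2sa.sub_holds h3sa).congr fun z _ => by simp only [Pi.sub_apply], h2i.sub h3i⟩ with hQ
  have hrel1 : of Rμ - of (E.prod K') - of Q ∈ relations := by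
    refine integrandAddRel_subset_relations ⟨2, Rμ, E.prod K', Q, by rw [hP1d, hRμd],
      by rw [hRμd], fun z hz => ?_, rfl⟩
    rw [hRμd] at hz
    have hz' : z 0 ∈ Ioo (0:ℝ) 1 ∧ z 1 ∈ Ioo (0:ℝ) 1 := hz
    rw [Pi.add_apply, hRμi z]
    simp only [hQ, hP1i z hz', hP2i z hz', hP3i z hz']
    ring
  have hrel2 : of (K.prod E') - of Q - of (K.prod K') ∈ relations := by
    refine integrandAddRel_subset_relations ⟨2, K.prod E', Q, K.prod K', by rw [hP2d],
      by rw [hP3d, hP2d], fun z _ => ?_, rfl⟩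
    simp only [Pi.add_apply, hQ]
    ring
  have hmem : of Rμ - (of (E.prod K') + of (K.prod E') - of (K.prod K')) ∈ relations := by
    have h := relations.sub_mem hrel1 hrel2
    have e : of Rμ - (of (E.prod K') + of (K.prod E') - of (K.prod K')) =
        of Rμ - of (E.prod K') - of Q - (of (K.prod E') - of Q - of (K.prod K')) := by abel
    rw [e]
    exact h
  have t1 : toFormalPeriod (of Rμ) = toFormalPeriod (of E) * toFormalPeriod (of K') +
      toFormalPeriod (of K) * toFormalPeriod (of E') - toFormalPeriod (of K) * toFormalPeriod (of K') := by
    rw [toFormalPeriod_of_mul_of, toFormalPeriod_of_mul_of, toFormalPeriod_of_mul_of, ← map_add,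
      ← map_sub]
    exact toFormalPeriod_eq_iff.mpr hmem
  have t2 : toFormalPeriod (of Rμ) = toFormalPeriod (of R₀) := toFormalPeriod_eq_iff.mpr hdef
  -- the undeformed end: `⟦R₀⟧ = ⟦arcsine⟧ · ⟦[(0,1),1]⟧ = ⟦arcsine⟧`
  obtain ⟨A, hAd, hAi⟩ := soloInformed_exists_arcsine_rep
  obtain ⟨I, hId, hIi, hI1⟩ := soloInformed_exists_unitInterval_rep
  obtain ⟨hAId, hAIi⟩ := soloInformed_prod_one_one A I (fun u => (√(1 - u ^ 2))⁻¹) (fun _ => 1)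
    hAd hId (fun x _ => hAi x) hIi
  have hm0 : of R₀ - of (A.prod I) ∈ relations := by
    refine of_sub_of_mem_relations_of_eqOn (by rw [hAId, hR₀d]) fun z hz => ?_
    rw [hR₀d] at hz
    have hz' : z 0 ∈ Ioo (0:ℝ) 1 ∧ z 1 ∈ Ioo (0:ℝ) 1 := hz
    rw [hR₀i z]
    simp only [hAIi z hz', mul_one]
  have t3 : toFormalPeriod (of R₀) = toFormalPeriod (of A) := by
    rw [toFormalPeriod_eq_iff.mpr hm0, ← toFormalPeriod_of_mul_of, hI1, mul_one]
  have t4 := soloInformed_two_mul_toFormalPeriod_arcsine A hAd (fun x _ => hAi x)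
  calc 2 * (toFormalPeriod (of E) * toFormalPeriod (of K') +
        toFormalPeriod (of E') * toFormalPeriod (of K) - toFormalPeriod (of K) * toFormalPeriod (of K'))
      = 2 * toFormalPeriod (of Rμ) := by rw [t1]; ring
    _ = 2 * toFormalPeriod (of A) := by rw [t2, t3]
    _ = toFormalPeriod (of KZ.piRep) := t4

/-- **Legendre's relation, numerically**: evaluating THEOREM XVII,
`2·(E·K' + E'·K − K·K') = π` for the values of the four representations. [this work] -/
theorem soloInformed_legendre_relation_value (μ : ℝ) (hμ : μ ∈ Ioo (0:ℝ) 1)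
    (hμa : IsAlgebraic ℚ μ) (K K' E E' : IntegralRep 1)
    (hKd : K.domain = {x : Fin 1 → ℝ | x 0 ∈ Ioo (0:ℝ) 1})
    (hKi : EqOn K.integrand (fun x => (√(1 - x 0 ^ 2))⁻¹ * (√(1 - μ * x 0 ^ 2))⁻¹) K.domain)
    (hK'd : K'.domain = {x : Fin 1 → ℝ | x 0 ∈ Ioo (0:ℝ) 1})
    (hK'i : EqOn K'.integrand
      (fun x => (√(1 - x 0 ^ 2))⁻¹ * (√(1 - (1 - μ) * x 0 ^ 2))⁻¹) K'.domain)
    (hEd : E.domain = {x : Fin 1 → ℝ | x 0 ∈ Ioo (0:ℝ) 1})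
    (hEi : EqOn E.integrand
      (fun x => (1 - μ * x 0 ^ 2) * ((√(1 - x 0 ^ 2))⁻¹ * (√(1 - μ * x 0 ^ 2))⁻¹)) E.domain)
    (hE'd : E'.domain = {x : Fin 1 → ℝ | x 0 ∈ Ioo (0:ℝ) 1})
    (hE'i : EqOn E'.integrand (fun x => (1 - (1 - μ) * x 0 ^ 2) *
      ((√(1 - x 0 ^ 2))⁻¹ * (√(1 - (1 - μ) * x 0 ^ 2))⁻¹)) E'.domain) :
    2 * (E.value * K'.value + E'.value * K.value - K.value * K'.value) = Real.pi := by
  have h := congrArg evalP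
    (soloInformed_legendre_relation μ hμ hμa K K' E E' hKd hKi hK'd hK'i hEd hEi hE'd hE'i)
  simpa [map_mul, map_add, map_sub, map_ofNat, evalP_toFormalPeriod_of, KZ.piRep_value] using h

/-- **THEOREM XVII with its hypotheses discharged**: for every real algebraic `μ ∈ (0,1)` the four
elliptic representations exist and satisfy Legendre's relation in the formal period ring.
[this work] -/
theorem soloInformed_legendre_relation_exists (μ : ℝ) (hμ : μ ∈ Ioo (0:ℝ) 1)
    (hμa : IsAlgebraic ℚ μ) :
    ∃ K K' E E' : IntegralRep 1,
      K.domain = {x : Fin 1 → ℝ | x 0 ∈ Ioo (0:ℝ) 1} ∧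
      (∀ x, K.integrand x = (√(1 - x 0 ^ 2))⁻¹ * (√(1 - μ * x 0 ^ 2))⁻¹) ∧
      K'.domain = {x : Fin 1 → ℝ | x 0 ∈ Ioo (0:ℝ) 1} ∧
      (∀ x, K'.integrand x = (√(1 - x 0 ^ 2))⁻¹ * (√(1 - (1 - μ) * x 0 ^ 2))⁻¹) ∧
      E.domain = {x : Fin 1 → ℝ | x 0 ∈ Ioo (0:ℝ) 1} ∧
      (∀ x, E.integrand x = (1 - μ * x 0 ^ 2) * ((√(1 - x 0 ^ 2))⁻¹ * (√(1 - μ * x 0 ^ 2))⁻¹)) ∧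
      E'.domain = {x : Fin 1 → ℝ | x 0 ∈ Ioo (0:ℝ) 1} ∧
      (∀ x, E'.integrand x = (1 - (1 - μ) * x 0 ^ 2) *
        ((√(1 - x 0 ^ 2))⁻¹ * (√(1 - (1 - μ) * x 0 ^ 2))⁻¹)) ∧
      2 * (toFormalPeriod (of E) * toFormalPeriod (of K') +
        toFormalPeriod (of E') * toFormalPeriod (of K) - toFormalPeriod (of K) * toFormalPeriod (of K'))
        = toFormalPeriod (of KZ.piRep) := by
  have hμ' : (1 - μ) ∈ Ioo (0:ℝ) 1 := ⟨by linarith [hμ.2], by linarith [hμ.1]⟩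
  have hμ'a : IsAlgebraic ℚ (1 - μ) := isAlgebraic_one.sub hμa
  obtain ⟨K, hKd, hKi⟩ := soloInformed_exists_ellipticK_rep μ hμ hμa
  obtain ⟨K', hK'd, hK'i⟩ := soloInformed_exists_ellipticK_rep (1 - μ) hμ' hμ'a
  obtain ⟨E, hEd, hEi⟩ := soloInformed_exists_ellipticE_rep μ hμ hμa
  obtain ⟨E', hE'd, hE'i⟩ := soloInformed_exists_ellipticE_rep (1 - μ) hμ' hμ'a
  exact ⟨K, K', E, E', hKd, hKi, hK'd, hK'i, hEd, hEi, hE'd, hE'i,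
    soloInformed_legendre_relation μ hμ hμa K K' E E' hKd (fun x _ => hKi x) hK'd
      (fun x _ => hK'i x) hEd (fun x _ => hEi x) hE'd (fun x _ => hE'i x)⟩

end Summit.KontsevichZagierPeriods.KontsevichZagierPeriods.Theorems

end
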